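import Literature.Probability.Percolation.FourFunctionsProdBernoulli
import HarnessLib

/-!
# The three Ahlswede–Daykin rectangles of the quadratic four-point row `Q44b` (all `n`, all weights)

Support file for crux `stmt-CriticalPhenomena-4575` (`NoHeavyLowerTail`; master-family programme, open
decreasing `E₃` orbit 44 of `…FrontierDecRowsLeFive`), seat `prim-l12-p6` gen 6; memo
`run/shared/lean/prim/prim-l12/FROM-prim-l12-p6-g6-Q44B-THREE-RECTANGLES.md`.

Bond percolation `μ = prodBernoulli w` with arbitrary edge weights on a finite vertex type, four vertices
`a b c y`, `P(π)` = probability that the open clusters induce the partition `π` of `{a,b,c,y}`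
(`∅ := a|b|c|y`).  The row `Q44b` of `prim-bnk-1` gen 13 (two-copy comb positive on `K₇`, hence a theorem on
`≤ 7` vertices; the one named row that leaves orbit 44 without a pseudo-law; OPEN for all `n`) is, after
exact regrouping of its eleven products,
  `P(a~b ∧ c~y)·P(∅) ≥ P(a~b ∧ D[ab|cy])·P(ac|by ∪ ay|bc) + P(ab|c|y)·P(c~y ∧ a≁b) + P(a|bcy)·P(ac|b|y ∪ ay|b|c)`.
Each of the three products on the right is a single FOUR-EVENTS (Ahlswede–Daykin) rectangle: a
configuration of the first event and one of the second INTERSECT in a configuration with `a,b,c,y`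
pairwise separated and UNITE in one with `a~b` and `c~y` (for the second and third product even
`a~b~c~y`).  This file proves the three rectangle inequalities for every finite weighted graph from the
tree's `prodBernoulli_fourEvents` (Bollobás–Riordan Ch. 2 Thm 7 / eq. (14) for the log-modular product
measure), in the maximal form of the first rectangle:
* `rectangle_main`:  `P(ab|c|y) · P(a≁b ∧ (c~y ∨ (a~c ∧ b~y) ∨ (a~y ∧ b~c))) ≤ P(∅) · P(a~b ∧ c~y)`
  (the five cells `a|b|cy, acy|b, a|bcy, ac|by, ay|bc` against `ab|c|y`; it contains the 'weak odds-ratio'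
  inequality `weakOddsRatio`: `P(ab|c|y)·P(c~y ∧ a≁b) ≤ P(∅)·P(a~b ∧ c~y)`, a refinement-free companion of
  Harris' `P(A¬C)P(¬AC) ≤ P(AC)P(¬A¬C)` for `A = {a~b}`, `C = {c~y}`);
* `rectangle_cross`: `P(a~b ∧ a≁c ∧ a≁y) · P(a≁b ∧ ((a~c ∧ b~y) ∨ (a~y ∧ b~c))) ≤ P(∅) · P(a~b ∧ a~c ∧ a~y)`;
* `rectangle_pendant`: `P(a≁b ∧ b~c ∧ b~y) · P(b≁a ∧ b≁c ∧ b≁y ∧ c≁y ∧ (a~c ∨ a~y)) ≤ P(∅) · P(a~b ∧ a~c ∧ a~y)`.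
Consequently the right-hand side of `Q44b` is at most `P(∅)·[P(a~b ∧ c~y) + 2·P(a~b~c~y)]`; `Q44b` itself is
the factor-one PACKING of the three rectangles into the single target and is NOT a single four-events
instance (the union of the three rectangles is not meet/join compatible: `ab|c|y ∨ ac|b|y = abc|y`), see the
memo.  Theorems only (no definitions, no named facts); standard axioms.
-/

namespace Summit.CriticalPhenomena.PercolationContinuityZ3.Theorems

namespace Q44bRectangles

open MeasureTheory Set
open Literature.Probability.LatticeModels (prodBernoulli)
open Literature.Probability.Percolation

variable {V : Type*} [Fintype V]

/-- **Main rectangle of `Q44b`** (maximal biclique of the compatibility relation 'meet = all separated,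
join ⊨ a~b ∧ c~y' through the cell `ab|c|y`): for `μ = prodBernoulli w` and vertices `a b c y`,
`μ(a~b, a≁c, a≁y, c≁y) · μ(a≁b ∧ (c~y ∨ (a~c ∧ b~y) ∨ (a~y ∧ b~c)))
   ≤ μ(a,b,c,y pairwise separated) · μ(a~b ∧ c~y)`.
Four-events form of Ahlswede–Daykin (`prodBernoulli_fourEvents`). [this work] -/
theorem rectangle_main (w : Sym2 V → unitInterval) (a b c y : V) :
    (prodBernoulli w).real (openConn a b ∩ (openConn a c)ᶜ ∩ (openConn a y)ᶜ ∩ (openConn c y)ᶜ) *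
        (prodBernoulli w).real ((openConn a b)ᶜ ∩
          (openConn c y ∪ (openConn a c ∩ openConn b y) ∪ (openConn a y ∩ openConn b c))) ≤
      (prodBernoulli w).real ((openConn a b)ᶜ ∩ (openConn a c)ᶜ ∩ (openConn a y)ᶜ ∩
          (openConn b c)ᶜ ∩ (openConn b y)ᶜ ∩ (openConn c y)ᶜ) *
        (prodBernoulli w).real (openConn a b ∩ openConn c y) := by
  refine prodBernoulli_fourEvents w _ _ _ _ fun ω hω ω' hω' => ?_
  have mem : ∀ (ω : BondConfig V) (u v : V),
      ω ∈ (openConn u v : Set (BondConfig V)) ↔ (openGraph ω).Reachable u v := fun _ _ _ => Iff.rfl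
  simp only [mem_inter_iff, mem_compl_iff, mem_union, mem] at hω hω' ⊢
  obtain ⟨⟨⟨hab, hac⟩, hay⟩, hcy⟩ := hω
  obtain ⟨hab', hcase⟩ := hω'
  have la : ∀ {u v : V}, (openGraph (ω ∩ ω')).Reachable u v → (openGraph ω).Reachable u v :=
    fun h => h.mono (BHK2006.openGraph_le inter_subset_left)
  have lb : ∀ {u v : V}, (openGraph (ω ∩ ω')).Reachable u v → (openGraph ω').Reachable u v :=
    fun h => h.mono (BHK2006.openGraph_le inter_subset_right)
  have ua : ∀ {u v : V}, (openGraph ω).Reachable u v → (openGraph (ω ∪ ω')).Reachable u v :=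
    fun h => h.mono (BHK2006.openGraph_le subset_union_left)
  have ub : ∀ {u v : V}, (openGraph ω').Reachable u v → (openGraph (ω ∪ ω')).Reachable u v :=
    fun h => h.mono (BHK2006.openGraph_le subset_union_right)
  -- in `ω`: b≁c and b≁y (else a~b~c resp. a~b~y)
  have hbc : ¬ (openGraph ω).Reachable b c := fun h => hac (hab.trans h)
  have hby : ¬ (openGraph ω).Reachable b y := fun h => hay (hab.trans h)
  refine ⟨⟨⟨⟨⟨⟨fun h => hab' (lb h), fun h => hac (la h)⟩, fun h => hay (la h)⟩,
    fun h => hbc (la h)⟩, fun h => hby (la h)⟩, fun h => hcy (la h)⟩, ua hab, ?_⟩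
  rcases hcase with (hcy' | ⟨hac', hby'⟩) | ⟨hay', hbc'⟩
  · exact ub hcy'
  · exact ((ub hac').symm.trans (ua hab)).trans (ub hby')
  · exact ((ub hbc').symm.trans (ua hab).symm).trans (ub hay')

/-- **Weak odds-ratio inequality** (the named sub-rectangle `{ab|c|y} × {c~y ∧ a≁b}` of `rectangle_main`):
`μ(a~b, a≁c, a≁y, c≁y) · μ(c~y ∧ a≁b) ≤ μ(a,b,c,y pairwise separated) · μ(a~b ∧ c~y)` for every finite
weighted graph — compare Harris' odds ratio, which has the larger `μ(a≁b ∧ c≁y)` in place of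
`μ(pairwise separated)` and the larger `μ(a~b ∧ c≁y)` in place of `μ(ab|c|y)`. [this work] -/
theorem weakOddsRatio (w : Sym2 V → unitInterval) (a b c y : V) :
    (prodBernoulli w).real (openConn a b ∩ (openConn a c)ᶜ ∩ (openConn a y)ᶜ ∩ (openConn c y)ᶜ) *
        (prodBernoulli w).real ((openConn a b)ᶜ ∩ openConn c y) ≤
      (prodBernoulli w).real ((openConn a b)ᶜ ∩ (openConn a c)ᶜ ∩ (openConn a y)ᶜ ∩
          (openConn b c)ᶜ ∩ (openConn b y)ᶜ ∩ (openConn c y)ᶜ) *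
        (prodBernoulli w).real (openConn a b ∩ openConn c y) := by
  refine le_trans ?_ (rectangle_main w a b c y)
  refine mul_le_mul_of_nonneg_left ?_ measureReal_nonneg
  refine measureReal_mono ?_
  intro ω hω
  simp only [mem_inter_iff, mem_compl_iff, mem_union] at hω ⊢
  exact ⟨hω.1, Or.inl (Or.inl hω.2)⟩

/-- **Crossing rectangle of `Q44b`**: `μ(a~b ∧ a≁c ∧ a≁y) · μ(a≁b ∧ ((a~c ∧ b~y) ∨ (a~y ∧ b~c)))
 ≤ μ(pairwise separated) · μ(a~b ∧ a~c ∧ a~y)` (a configuration of `{ab|c|y, ab|cy}` and a crossing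
matching `ac|by` / `ay|bc` meet in the discrete partition and join in the connected one).
[this work] -/
theorem rectangle_cross (w : Sym2 V → unitInterval) (a b c y : V) :
    (prodBernoulli w).real (openConn a b ∩ (openConn a c)ᶜ ∩ (openConn a y)ᶜ) *
        (prodBernoulli w).real ((openConn a b)ᶜ ∩
          ((openConn a c ∩ openConn b y) ∪ (openConn a y ∩ openConn b c))) ≤
      (prodBernoulli w).real ((openConn a b)ᶜ ∩ (openConn a c)ᶜ ∩ (openConn a y)ᶜ ∩
          (openConn b c)ᶜ ∩ (openConn b y)ᶜ ∩ (openConn c y)ᶜ) *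
        (prodBernoulli w).real (openConn a b ∩ openConn a c ∩ openConn a y) := by
  refine prodBernoulli_fourEvents w _ _ _ _ fun ω hω ω' hω' => ?_
  have mem : ∀ (ω : BondConfig V) (u v : V),
      ω ∈ (openConn u v : Set (BondConfig V)) ↔ (openGraph ω).Reachable u v := fun _ _ _ => Iff.rfl
  simp only [mem_inter_iff, mem_compl_iff, mem_union, mem] at hω hω' ⊢
  obtain ⟨⟨hab, hac⟩, hay⟩ := hω
  obtain ⟨hab', hcase⟩ := hω'
  have la : ∀ {u v : V}, (openGraph (ω ∩ ω')).Reachable u v → (openGraph ω).Reachable u v :=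
    fun h => h.mono (BHK2006.openGraph_le inter_subset_left)
  have lb : ∀ {u v : V}, (openGraph (ω ∩ ω')).Reachable u v → (openGraph ω').Reachable u v :=
    fun h => h.mono (BHK2006.openGraph_le inter_subset_right)
  have ua : ∀ {u v : V}, (openGraph ω).Reachable u v → (openGraph (ω ∪ ω')).Reachable u v :=
    fun h => h.mono (BHK2006.openGraph_le subset_union_left)
  have ub : ∀ {u v : V}, (openGraph ω').Reachable u v → (openGraph (ω ∪ ω')).Reachable u v :=
    fun h => h.mono (BHK2006.openGraph_le subset_union_right)
  have hbc : ¬ (openGraph ω).Reachable b c := fun h => hac (hab.trans h)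
  have hby : ¬ (openGraph ω).Reachable b y := fun h => hay (hab.trans h)
  -- in `ω'`: c≁y (else the matching would join a and b)
  have hcy' : ¬ (openGraph ω').Reachable c y := by
    intro h
    rcases hcase with ⟨hac', hby'⟩ | ⟨hay', hbc'⟩
    · exact hab' ((hac'.trans h).trans hby'.symm)
    · exact hab' ((hay'.trans h.symm).trans hbc'.symm)
  refine ⟨⟨⟨⟨⟨⟨fun h => hab' (lb h), fun h => hac (la h)⟩, fun h => hay (la h)⟩,
    fun h => hbc (la h)⟩, fun h => hby (la h)⟩, fun h => hcy' (lb h)⟩, ⟨ua hab, ?_⟩, ?_⟩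
  · rcases hcase with ⟨hac', _⟩ | ⟨hay', hbc'⟩
    · exact ub hac'
    · exact (ua hab).trans (ub hbc')
  · rcases hcase with ⟨_, hby'⟩ | ⟨hay', _⟩
    · exact (ua hab).trans (ub hby')
    · exact ub hay'

/-- **Pendant rectangle of `Q44b`**: `μ(a≁b ∧ b~c ∧ b~y) · μ(b≁a ∧ b≁c ∧ b≁y ∧ c≁y ∧ (a~c ∨ a~y))
 ≤ μ(pairwise separated) · μ(a~b ∧ a~c ∧ a~y)` (the cell `a|bcy` against the cells `ac|b|y, ay|b|c`).
[this work] -/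
theorem rectangle_pendant (w : Sym2 V → unitInterval) (a b c y : V) :
    (prodBernoulli w).real ((openConn a b)ᶜ ∩ openConn b c ∩ openConn b y) *
        (prodBernoulli w).real ((openConn a b)ᶜ ∩ (openConn b c)ᶜ ∩ (openConn b y)ᶜ ∩ (openConn c y)ᶜ ∩
          (openConn a c ∪ openConn a y)) ≤
      (prodBernoulli w).real ((openConn a b)ᶜ ∩ (openConn a c)ᶜ ∩ (openConn a y)ᶜ ∩
          (openConn b c)ᶜ ∩ (openConn b y)ᶜ ∩ (openConn c y)ᶜ) *
        (prodBernoulli w).real (openConn a b ∩ openConn a c ∩ openConn a y) := by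
  refine prodBernoulli_fourEvents w _ _ _ _ fun ω hω ω' hω' => ?_
  have mem : ∀ (ω : BondConfig V) (u v : V),
      ω ∈ (openConn u v : Set (BondConfig V)) ↔ (openGraph ω).Reachable u v := fun _ _ _ => Iff.rfl
  simp only [mem_inter_iff, mem_compl_iff, mem_union, mem] at hω hω' ⊢
  obtain ⟨⟨hab, hbc⟩, hby⟩ := hω
  obtain ⟨⟨⟨⟨hab', hbc'⟩, hby'⟩, hcy'⟩, hcase⟩ := hω'
  have la : ∀ {u v : V}, (openGraph (ω ∩ ω')).Reachable u v → (openGraph ω).Reachable u v :=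
    fun h => h.mono (BHK2006.openGraph_le inter_subset_left)
  have lb : ∀ {u v : V}, (openGraph (ω ∩ ω')).Reachable u v → (openGraph ω').Reachable u v :=
    fun h => h.mono (BHK2006.openGraph_le inter_subset_right)
  have ua : ∀ {u v : V}, (openGraph ω).Reachable u v → (openGraph (ω ∪ ω')).Reachable u v :=
    fun h => h.mono (BHK2006.openGraph_le subset_union_left)
  have ub : ∀ {u v : V}, (openGraph ω').Reachable u v → (openGraph (ω ∪ ω')).Reachable u v :=
    fun h => h.mono (BHK2006.openGraph_le subset_union_right)
  -- in `ω`: a≁c and a≁y (else a~c~b resp. a~y~b)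
  have hac : ¬ (openGraph ω).Reachable a c := fun h => hab (h.trans hbc.symm)
  have hay : ¬ (openGraph ω).Reachable a y := fun h => hab (h.trans hby.symm)
  refine ⟨⟨⟨⟨⟨⟨fun h => hab (la h), fun h => hac (la h)⟩, fun h => hay (la h)⟩,
    fun h => hbc' (lb h)⟩, fun h => hby' (lb h)⟩, fun h => hcy' (lb h)⟩, ?_⟩
  rcases hcase with hac' | hay'
  · exact ⟨⟨(ub hac').trans (ua hbc).symm, ub hac'⟩, ((ub hac').trans (ua hbc).symm).trans (ua hby)⟩
  · exact ⟨⟨(ub hay').trans (ua hby).symm, ((ub hay').trans (ua hby).symm).trans (ua hbc)⟩, ub hay'⟩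

end Q44bRectangles

end Summit.CriticalPhenomena.PercolationContinuityZ3.Theorems
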